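import Literature.InformationTheory.QuantumCodes.UnionFindDecoderRadius
import Literature.InformationTheory.QuantumCodes.ToricCodeDuality
import HarnessLib

/-!
# The Union-Find decoder for bit-flip errors of the toric code (Algorithm 1 on the dual lattice)

Topic `Literature/InformationTheory/QuantumCodes` (qec cell, LIT-2 lane «union-find», LADDER-QEC Q4). PROVED, no
named fact, no sorry. Delfosse–Nickerson 2021 treat phase flips and add "The `X`-part of a Pauli error can be
corrected identically" (§1, error model); on the `L × L` toric code this is the lattice self-duality of
`ToricCodeDuality.lean` (`dualEdge (v,i) = (-v, 1-i)`, `dualChain`, `H^Z x = (H^X x^*) ∘ neg`). We define the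
`X`-sector Union-Find decoder `ufDecoderX R` — read the plaquette syndrome at the antipodal sites as a star
syndrome, run the `Z`-sector decoder `UnionFind.ufDecoder` of `UnionFindDecoder.lean` with the dual erasure
`δ(R)`, dualise the correction — and transfer Theorem 1 (`UnionFindDecoderRadius.lean`):

* `ufDecoderX_corrects` — `|R| + 2·|supp x \ R| < L` ⇒ the bit-flip pattern `x` with erasure `R` is corrected
  (residual in the row space of `H^X`);
* `ufDecoderX_correctsUpTo`, `ufDecoderX_isCorrectionRadius` — without erasure the `X`-radius is exactly
  `⌊(L-1)/2⌋`, the optimal bit-flip radius (`ToricCode.optimalRadiusX`).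

## References
[cite: DelfosseNickerson2021, §1 (error model: "The X-part of a Pauli error can be corrected identically"), §3 Theorem 1]
[cite: DennisEtAl2002, §3.1, §4.1 (X errors are Z errors of the dual lattice, treated separately and identically)]
-/

noncomputable section

namespace Literature.InformationTheory.QuantumCodes

namespace ToricCode

namespace UnionFind

open Finset Matrix

variable {L : ℕ} [NeZero L]

/-- **The Union-Find decoder for `X`-errors** of the `L × L` toric code with erasure `R`: Algorithm 1 on the dual
lattice — the plaquette syndrome read at the antipodal sites is a star syndrome (`plaquetteMatrix_mulVec`), decode
it with the dual erasure `δ(R)`, dualise the correction.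
[cite: DelfosseNickerson2021, §1 (error model) and §2 Algorithm 1] [cite: DennisEtAl2002, §4.1] -/
def ufDecoderX (R : Finset (Edge L)) : Decoder (Vertex L → ZMod 2) (Chain L) :=
  fun σ => dualChain (ufDecoder (R.map (dualEdge L).toEmbedding) fun s => σ (-s))

/-- On the plaquette syndrome of `x` the `X`-decoder returns the dual of the `Z`-decoder's output on `∂(x^*)`.
[cite: DennisEtAl2002, §4.1 (decode X errors on the dual lattice)] -/
theorem ufDecoderX_xSyndrome (R : Finset (Edge L)) (x : Chain L) :
    ufDecoderX R ((toricCode L).xSyndrome x) =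
      dualChain (ufDecoder (R.map (dualEdge L).toEmbedding) (syn L (dualChain x))) := by
  unfold ufDecoderX
  have h : (fun s => (toricCode L).xSyndrome x (-s)) = syn L (dualChain x) := by
    funext s
    change (plaquetteMatrix L *ᵥ x) (-s) = (starMatrix L *ᵥ dualChain x) s
    rw [plaquetteMatrix_mulVec, neg_neg]
  rw [h]

/-- The un-erased support dualises: `supp x^* \ δ(R) = δ(supp x \ R)`, so the counts agree.
[cite: DennisEtAl2002, §3.1 (self-duality of the square lattice)] -/
theorem card_supp_dualChain_sdiff (R : Finset (Edge L)) (x : Chain L) :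
    (supp (dualChain x) \ R.map (dualEdge L).toEmbedding).card = (supp x \ R).card := by
  have hsymm : ∀ ℓ : Edge L, (dualEdge L).symm ℓ = dualEdge L ℓ := fun _ => rfl
  have h : supp (dualChain x) \ R.map (dualEdge L).toEmbedding = (supp x \ R).map (dualEdge L).toEmbedding := by
    ext ℓ
    simp only [Finset.mem_sdiff, Finset.mem_map_equiv, hsymm, supp, Finset.mem_filter, Finset.mem_univ,
      true_and, dualChain]
  rw [h, Finset.card_map]

/-- **Theorem 1 for bit flips**: with `|R| + 2·|supp x \ R| < L` the `X`-sector Union-Find decoder corrects the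
bit-flip pattern `x` (the residual is a product of star operators).
[cite: DelfosseNickerson2021, §3 Theorem 1 with §1 ("the X-part … can be corrected identically")] -/
theorem ufDecoderX_corrects (R : Finset (Edge L)) (x : Chain L) (h : R.card + 2 * (supp x \ R).card < L) :
    (ufDecoderX R).Corrects (toricCode L).xSyndrome ((toricCode L).rowSpX : Set (Chain L)) x := by
  rw [Decoder.corrects_iff, ufDecoderX_xSyndrome]
  have h' : (R.map (dualEdge L).toEmbedding).card +
      2 * (supp (dualChain x) \ R.map (dualEdge L).toEmbedding).card < L := by
    rwa [Finset.card_map, card_supp_dualChain_sdiff]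
  have hz := ufDecoder_corrects (R.map (dualEdge L).toEmbedding) (dualChain x) h'
  rw [ufDecoder_corrects_iff] at hz
  rw [show dualChain (ufDecoder (R.map (dualEdge L).toEmbedding) (syn L (dualChain x))) + x =
      dualChain (ufDecoder (R.map (dualEdge L).toEmbedding) (syn L (dualChain x)) + dualChain x) by
    rw [dualChain_add, dualChain_dualChain]]
  exact (dualChain_mem_boundaries_iff _).1 (by rwa [dualChain_dualChain])

/-- **Without erasure the `X`-sector Union-Find decoder corrects every bit-flip pattern of weight `≤ ⌊(L-1)/2⌋`.**
[cite: DelfosseNickerson2021, §3 Theorem 1 (t = 0), §1] -/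
theorem ufDecoderX_correctsUpTo :
    (ufDecoderX (∅ : Finset (Edge L))).CorrectsUpTo (toricCode L).xSyndrome
      ((toricCode L).rowSpX : Set (Chain L)) hammingNorm ((L - 1) / 2) := by
  intro x hx
  apply ufDecoderX_corrects
  have hcard : (supp x \ ∅).card = hammingNorm x := by rw [Finset.sdiff_empty]; rfl
  rw [Finset.card_empty, hcard]
  have := NeZero.ne L
  omega

/-- **The `X`-sector Union-Find decoder attains the optimal bit-flip radius `⌊(L-1)/2⌋`** (`ToricCode.optimalRadiusX`).
[cite: DelfosseNickerson2021, §3 ¶2 and Theorem 1, §1] -/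
theorem ufDecoderX_isCorrectionRadius :
    (ufDecoderX (∅ : Finset (Edge L))).IsCorrectionRadius (toricCode L).xSyndrome
      ((toricCode L).rowSpX : Set (Chain L)) hammingNorm ((L - 1) / 2) := by
  refine ⟨ufDecoderX_correctsUpTo, fun h => ?_⟩
  have := (optimalRadiusX (L := L)).2 _ _ h
  omega

end UnionFind

end ToricCode

end Literature.InformationTheory.QuantumCodes
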